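import Mathlib

/-!
# Route FilamentSkeletonRss · crux `CoreGluing` (stmt-NavierStokesRegularity-15401) — line `Sketch`,
# stub `stub_inviscidEndHasNeutralMode`: the inviscid end operator has a neutral mode

Helper file (theorems only) for the skeleton of the crux `CoreGluing`. The local-induction
(binormal-flow) end equation of an inviscid vortex filament, linearised about a straight end,
is the complex ODE `i c ζ'' − w ζ' = 0` (`c ≠ 0` the self-induction coefficient, `w` the
tangential material speed). Besides the constants it always has a bounded oscillatory solution
with `|ζ'| ≡ 1` — a neutral helical Kelvin wave — so the inviscid end operator is not Volterra
(card `volterra-ends`, sketch `InviscidEndHasNeutralMode`).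

Proof: an explicit construction. With `W := ∫₀ w` put `η := exp (−i W / c)` (the intended `ζ'`)
and `ζ := ∫₀ η`. Then `|η| = 1`, `η' = −(i w / c) η`, hence `i c ζ'' − w ζ' = i c η' − w η =
(−i·i) (c/c) w η − w η = 0`. Mathlib only (FTC-1 `Continuous.integral_hasStrictDerivAt`, the
chain rule for `Complex.exp`, `Complex.norm_exp_ofReal_mul_I`).
-/

-- the summit and its single sub-problem share the name (CONVENTIONS §1), as in every Theorems file
set_option linter.dupNamespace false

namespace Summit.NavierStokesRegularity.NavierStokesRegularity.Theorems

open Set Filter MeasureTheory Topology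

/-- The neutral mode from a primitive `W` of the tangential speed `w`: `ζ := ∫₀ exp (−i W / c)`
is `C²` with `|ζ'| ≡ 1` and solves `i c ζ'' − w ζ' = 0`. -/
private theorem inviscidEnd_neutralMode_of_primitive {c : ℝ} {w W : ℝ → ℝ} (hc : c ≠ 0)
    (hW : ∀ τ, HasDerivAt W (w τ) τ) :
    ∃ ζ : ℝ → ℂ, Differentiable ℝ ζ ∧ Differentiable ℝ (deriv ζ) ∧ (∀ τ, ‖deriv ζ τ‖ = 1) ∧
      ∀ τ, (c : ℂ) * Complex.I * deriv (deriv ζ) τ - (w τ : ℂ) * deriv ζ τ = 0 := by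
  -- the phase `η = exp (−i W / c)` (the intended `ζ'`) and its derivative `η' = −(i w / c) η`
  obtain ⟨η, hη⟩ :
      ∃ η : ℝ → ℂ, η = fun τ => Complex.exp (((-(W τ / c) : ℝ) : ℂ) * Complex.I) := ⟨_, rfl⟩
  have hηd : ∀ τ, HasDerivAt η (η τ * (((-(w τ / c) : ℝ) : ℂ) * Complex.I)) τ := fun τ => by
    rw [hη]
    exact (((hW τ).div_const c).neg.ofReal_comp.mul_const Complex.I).cexp
  have hηc : Continuous η := continuous_iff_continuousAt.2 fun τ => (hηd τ).continuousAt
  -- `ζ := ∫₀ η`, so `ζ' = η` everywhere (FTC-1 for the continuous integrand `η`)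
  obtain ⟨ζ, hζ⟩ : ∃ ζ : ℝ → ℂ, ζ = fun τ => ∫ s in (0 : ℝ)..τ, η s := ⟨_, rfl⟩
  have hζd : ∀ τ, HasDerivAt ζ (η τ) τ := fun τ => by
    rw [hζ]
    exact (hηc.integral_hasStrictDerivAt 0 τ).hasDerivAt
  have hdζ : deriv ζ = η := funext fun τ => (hζd τ).deriv
  refine ⟨ζ, fun τ => (hζd τ).differentiableAt, ?_, ?_, ?_⟩
  · rw [hdζ]
    exact fun τ => (hηd τ).differentiableAt
  · rw [hdζ, hη]
    exact fun τ => Complex.norm_exp_ofReal_mul_I _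
  · intro τ
    rw [hdζ, (hηd τ).deriv, Complex.ofReal_neg, Complex.ofReal_div]
    have hc' : (c : ℂ) ≠ 0 := Complex.ofReal_ne_zero.2 hc
    have key : (c : ℂ) * Complex.I * (η τ * (-((w τ : ℂ) / c) * Complex.I)) =
        -(Complex.I * Complex.I) * ((c : ℂ) / c) * ((w τ : ℂ) * η τ) := by
      ring
    rw [key, Complex.I_mul_I, div_self hc']
    ring

/-- **stub_inviscidEndHasNeutralMode (card volterra-ends).** For every self-induction coefficient
`c ≠ 0` and every continuous tangential speed `w`, the linearised inviscid end equation
`i c ζ'' − w ζ' = 0` has a solution `ζ` with `ζ`, `ζ'` differentiable and `|ζ'| ≡ 1` — the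
neutral helical Kelvin wave `ζ = ∫₀ exp (−(i/c) ∫₀ w)`; in particular the inviscid end operator
is not Volterra. -/
theorem stub_inviscidEndHasNeutralMode : ∀ (c : ℝ) (w : ℝ → ℝ), c ≠ 0 → Continuous w → ∃ ζ : ℝ → ℂ, Differentiable ℝ ζ ∧ Differentiable ℝ (deriv ζ) ∧ (∀ τ, ‖deriv ζ τ‖ = 1) ∧ ∀ τ, (c : ℂ) * Complex.I * deriv (deriv ζ) τ - (w τ : ℂ) * deriv ζ τ = 0 := by
  intro c w hc hw
  exact inviscidEnd_neutralMode_of_primitive hc fun τ => (hw.integral_hasStrictDerivAt 0 τ).hasDerivAt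

end Summit.NavierStokesRegularity.NavierStokesRegularity.Theorems
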